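import Summits.Ventures.HodgeRepro2.InvariantVolume
import Summits.Ventures.HodgeRepro2.BallAnalytic
import Summits.Ventures.HodgeRepro2.BallMulAction

/-!
# The Bergman measure on the ball is `U(2,1)`-invariant

Kernel support for the blind cell pub-hodge-repro2 (seat p2), T5-ID §ID-4(b′) (the invariant volume form of
`𝔹² = U(2,1)/K₁` against which the Petersson pairing is taken).  Row 89 (`InvariantVolume.lean`) proved the
pointwise identity `|det J_α(z)|² · (1 − ‖αz‖²)^{-3} = (1 − ‖z‖²)^{-3}`; this file turns it into a
statement about MEASURES with Mathlib's change-of-variables theorem: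

* `bergmanMeasure := (volume|_{𝔹²}).withDensity (1 − ‖z‖²)^{-3}` on `Fin 2 → ℂ`;
* `map_ballAction_bergmanMeasure`: for `α ∈ U(2,1)`, `Measure.map (ballAction α) bergmanMeasure = bergmanMeasure`;
* the integral form `∫ g(αz) dμ_B(z) = ∫ g(w) dμ_B(w)` and its set-integral version against Lebesgue measure.

The real determinant of the `ℝ`-linear restriction of the complex Jacobian is `|det_ℂ J_α(z)|²`
(`LinearMap.det_restrictScalars` + `Algebra.norm_complex_apply`).  Not formalised: the descent of the
measure to the quotient `Γ\𝔹²` (a fundamental domain), and the identification with Haar measure on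
`U(2,1)` (prose in N1).
-/

namespace Summit.Ventures.HodgeRepro2.ShimuraData

open MeasureTheory

section Jacobian

/-- The Jacobian matrix of row 81 is the matrix of the complex Fréchet derivative in the standard basis. -/
theorem jacobian_eq_toMatrix' (α : Matrix (Fin 3) (Fin 3) ℂ) (z : Fin 2 → ℂ) :
    jacobian α z = LinearMap.toMatrix' (fderiv ℂ (ballAction α) z : (Fin 2 → ℂ) →ₗ[ℂ] (Fin 2 → ℂ)) := by
  ext i j
  simp [jacobian, LinearMap.toMatrix'_apply]

/-- The complex determinant of the derivative is `det J_α(z)`. -/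
theorem det_fderiv_ballAction (α : Matrix (Fin 3) (Fin 3) ℂ) (z : Fin 2 → ℂ) :
    LinearMap.det (fderiv ℂ (ballAction α) z : (Fin 2 → ℂ) →ₗ[ℂ] (Fin 2 → ℂ)) = (jacobian α z).det := by
  rw [jacobian_eq_toMatrix', LinearMap.det_toMatrix']

/-- **The real Jacobian determinant is `|det_ℂ J_α(z)|²`**: the determinant of the derivative viewed as an
`ℝ`-linear map of `ℂ² = ℝ⁴` is the square of the norm of the complex determinant. -/
theorem det_restrictScalars_fderiv_ballAction (α : Matrix (Fin 3) (Fin 3) ℂ) (z : Fin 2 → ℂ) :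
    ((fderiv ℂ (ballAction α) z).restrictScalars ℝ).det = ‖(jacobian α z).det‖ ^ 2 := by
  rw [ContinuousLinearMap.det, ContinuousLinearMap.coe_restrictScalars, LinearMap.det_restrictScalars,
    det_fderiv_ballAction, Algebra.norm_complex_apply, Complex.normSq_eq_norm_sq]

end Jacobian

section Bijection

/-- `α⁻¹` undoes `α` on the ball. -/
theorem IsInU21.ballAction_inv_ballAction {α : Matrix (Fin 3) (Fin 3) ℂ} (hα : IsInU21 α) {z : Fin 2 → ℂ}
    (hz : z ∈ ball₂) : ballAction α⁻¹ (ballAction α z) = z := by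
  rw [← IsInU21.ballAction_mul hα hz, Matrix.nonsing_inv_mul α hα.isUnit_det, ballAction_one]

/-- `α` undoes `α⁻¹` on the ball. -/
theorem IsInU21.ballAction_ballAction_inv {α : Matrix (Fin 3) (Fin 3) ℂ} (hα : IsInU21 α) {z : Fin 2 → ℂ}
    (hz : z ∈ ball₂) : ballAction α (ballAction α⁻¹ z) = z := by
  rw [← IsInU21.ballAction_mul hα.inv hz, Matrix.mul_nonsing_inv α hα.isUnit_det, ballAction_one]

/-- `α ∈ U(2,1)` acts injectively on the ball. -/
theorem IsInU21.injOn_ballAction {α : Matrix (Fin 3) (Fin 3) ℂ} (hα : IsInU21 α) :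
    Set.InjOn (ballAction α) ball₂ := fun z hz w hw h => by
  rw [← hα.ballAction_inv_ballAction hz, h, hα.ballAction_inv_ballAction hw]

/-- `α ∈ U(2,1)` maps the ball onto itself. -/
theorem IsInU21.image_ballAction {α : Matrix (Fin 3) (Fin 3) ℂ} (hα : IsInU21 α) :
    ballAction α '' ball₂ = ball₂ := by
  ext w
  constructor
  · rintro ⟨z, hz, rfl⟩
    exact hα.ballAction_mem_ball₂ hz
  · intro hw
    exact ⟨ballAction α⁻¹ w, hα.inv.ballAction_mem_ball₂ hw, hα.ballAction_ballAction_inv hw⟩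

/-- The real derivative of `ballAction α` on the ball (restriction of scalars of the complex derivative). -/
theorem IsInU21.hasFDerivWithinAt_ballAction_real {α : Matrix (Fin 3) (Fin 3) ℂ} (hα : IsInU21 α)
    {z : Fin 2 → ℂ} (hz : z ∈ ball₂) :
    HasFDerivWithinAt (ballAction α) ((fderiv ℂ (ballAction α) z).restrictScalars ℝ) ball₂ z :=
  ((hα.differentiableAt_ballAction hz).hasFDerivAt.restrictScalars ℝ).hasFDerivWithinAt

end Bijection

section Measure

/-- `ballAction α` is measurable (a quotient of continuous functions). -/
theorem measurable_ballAction (α : Matrix (Fin 3) (Fin 3) ℂ) : Measurable (ballAction α) := by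
  unfold ballAction
  refine measurable_pi_lambda _ fun k => ?_
  exact ((contDiff_mulVec_homog_apply α k.castSucc).continuous.measurable).div
    ((contDiff_mulVec_homog_apply α (Fin.last 2)).continuous.measurable)

/-- The ball is measurable (it is open). -/
theorem measurableSet_ball₂ : MeasurableSet ball₂ := isOpen_ball₂.measurableSet

/-- The volume density is measurable. -/
theorem measurable_volumeDensity : Measurable volumeDensity := by
  have h : Continuous normSq₂ := by
    unfold normSq₂
    fun_prop
  unfold volumeDensity
  exact ((continuous_const.sub h).pow 3).measurable.inv

/-- The Bergman measure on the ball: Lebesgue measure restricted to `𝔹²` with density `(1 − ‖z‖²)^{-3}`. -/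
noncomputable def bergmanMeasure : Measure (Fin 2 → ℂ) :=
  (volume.restrict ball₂).withDensity fun z => ENNReal.ofReal (volumeDensity z)

/-- **Change of variables for the Bergman density** (lower integral form): for `α ∈ U(2,1)` and every
`g : 𝔹² → [0, ∞]`, `∫⁻_{𝔹²} g(αz) (1 − ‖z‖²)^{-3} dz = ∫⁻_{𝔹²} g(w) (1 − ‖w‖²)^{-3} dw`. -/
theorem lintegral_ballAction_mul_volumeDensity {α : Matrix (Fin 3) (Fin 3) ℂ} (hα : IsInU21 α)
    (g : (Fin 2 → ℂ) → ENNReal) :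
    ∫⁻ z in ball₂, g (ballAction α z) * ENNReal.ofReal (volumeDensity z) =
      ∫⁻ w in ball₂, g w * ENNReal.ofReal (volumeDensity w) := by
  have h := lintegral_image_eq_lintegral_abs_det_fderiv_mul volume measurableSet_ball₂
    (fun z hz => hα.hasFDerivWithinAt_ballAction_real hz) hα.injOn_ballAction
    (fun w => g w * ENNReal.ofReal (volumeDensity w))
  rw [hα.image_ballAction] at h
  rw [h]
  refine setLIntegral_congr_fun measurableSet_ball₂ fun z hz => ?_
  rw [det_restrictScalars_fderiv_ballAction, abs_of_nonneg (by positivity),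
    ← volumeDensity_ballAction hα hz, ENNReal.ofReal_mul (by positivity)]
  ring

/-- **The Bergman measure is `U(2,1)`-invariant**: `(ballAction α)_* μ_B = μ_B` for `α ∈ U(2,1)`. -/
theorem map_ballAction_bergmanMeasure {α : Matrix (Fin 3) (Fin 3) ℂ} (hα : IsInU21 α) :
    Measure.map (ballAction α) bergmanMeasure = bergmanMeasure := by
  refine Measure.ext_of_lintegral _ fun f hf => ?_
  rw [lintegral_map hf (measurable_ballAction α)]
  unfold bergmanMeasure
  rw [lintegral_withDensity_eq_lintegral_mul _ measurable_volumeDensity.ennreal_ofReal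
    (g := fun a => f (ballAction α a)) (hf.comp (measurable_ballAction α)),
    lintegral_withDensity_eq_lintegral_mul _ measurable_volumeDensity.ennreal_ofReal hf]
  have h := lintegral_ballAction_mul_volumeDensity hα f
  simp only [Pi.mul_apply]
  simp only [mul_comm] at h ⊢
  exact h

/-- The integral of `g ∘ α` against the Bergman measure equals the integral of `g`
(`α ∈ U(2,1)`, `g` a.e.-strongly measurable). -/
theorem integral_ballAction_bergmanMeasure {α : Matrix (Fin 3) (Fin 3) ℂ} (hα : IsInU21 α)
    {F : Type*} [NormedAddCommGroup F] [NormedSpace ℝ F] {g : (Fin 2 → ℂ) → F}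
    (hg : AEStronglyMeasurable g bergmanMeasure) :
    ∫ z, g (ballAction α z) ∂bergmanMeasure = ∫ w, g w ∂bergmanMeasure := by
  rw [← integral_map (measurable_ballAction α).aemeasurable
    (by rwa [map_ballAction_bergmanMeasure hα]), map_ballAction_bergmanMeasure hα]

/-- **Change of variables for the Bergman density** (Bochner form, against Lebesgue measure): for
`α ∈ U(2,1)` and every `g` with values in a Banach space,
`∫_{𝔹²} (1 − ‖z‖²)^{-3} • g(αz) dz = ∫_{𝔹²} (1 − ‖w‖²)^{-3} • g(w) dw`. -/
theorem setIntegral_volumeDensity_smul_ballAction {α : Matrix (Fin 3) (Fin 3) ℂ} (hα : IsInU21 α)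
    {F : Type*} [NormedAddCommGroup F] [NormedSpace ℝ F] (g : (Fin 2 → ℂ) → F) :
    ∫ z in ball₂, volumeDensity z • g (ballAction α z) = ∫ w in ball₂, volumeDensity w • g w := by
  have h := integral_image_eq_integral_abs_det_fderiv_smul volume measurableSet_ball₂
    (fun z hz => hα.hasFDerivWithinAt_ballAction_real hz) hα.injOn_ballAction
    (fun w => volumeDensity w • g w)
  rw [hα.image_ballAction] at h
  rw [h]
  refine setIntegral_congr_fun measurableSet_ball₂ fun z hz => ?_
  rw [det_restrictScalars_fderiv_ballAction, abs_of_nonneg (by positivity), smul_smul,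
    volumeDensity_ballAction hα hz]

end Measure

end Summit.Ventures.HodgeRepro2.ShimuraData
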